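import Summits.BirchSwinnertonDyer.Rank1Residual.X11b.BDPRouteOpenInputIntFrame
import Summits.BirchSwinnertonDyer.Rank1Residual.X11b.BDPRouteOpenInputPrintRecord
import HarnessLib

/-!
# Class X11b, route p2 at `p ≥ 5`: PER-PAIR CLOSURES, THE SEMISTABLE END STATE AND THE CLASS RECORD
# OVER THE `R₀`-FREE FRAME FORM H∃♭ — no `h32`, no `R₀` in the type of the open input
# (cell `b2b-bsdres`, sub-cell `multr1-p2`, gen 24; companion of `BDPRouteOpenInputIntFrame.lean`)

HONEST FRAMING (cell `b2b-bsdres`, run/shared/lean/b2b/bsd-rank1-residual/, verbatim in every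
file): the goal of the cell is to DELETE the COMBINATION-SHAPED residual classes of the
Birch–Swinnerton-Dyer formula for ALL analytic-rank `≤ 1` elliptic curves over `ℚ` — "full BSD
formula for every rank `≤ 1` curve in class `C`" assembled STRICTLY from published theorems — so
that the rank-`≤ 1` remainder becomes exactly the CONSTRUCTION-SHAPED classes, which are TYPED
(missing-input `Prop`s), NOT attempted. This is not "finishing BSD". Sub-cell `multr1-p2` is a
RESEARCH ROUTE on class X11b (`ClassX11b W p := r_an = 1 ∧ p ≠ 2 ∧ mult(p) ∧ irr(p)`,
`Partition/Rows.lean`); no claim beyond the stated class and loci; X11b's label does not change;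
NOTHING is booked by this file.

THEOREMS ONLY (no definition, no named fact, no `sorry`); every result is CONDITIONAL on the OPEN
shape `P2.IMCDivIntFrameOnTree` (H∃♭) of the companion file.

## What this file records (gen 24)

With the composite open input assembled from H∃♭ on every pair
(`P2.openInputOnTreeAt_of_imcDivIntFrame`), every gen-21/22/23 consumer of the composite is restated
over H∃♭ — the typed open input of route p2 now carries NO coefficient ring smaller than `𝓞_{ℂ_p}`
in its type, and NO `h32` / semistability case split:

* §1 PER-PAIR CLOSURES off the Locus: `P2.bsdp_of_surj_of_imcDivIntFrame_of_regulatorNonvanishing`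
  (any X11b ∧ surj pair, `p ≥ 5`: H∃♭ + ONE `p`-adic height (+ Disegni's (∗) if split at `p`)),
  `P2.bsdp_and_bsdp_twist_of_imcDivIntFrame_of_twistUnit` (`p ∤ ∏c`: H∃♭ + ONE twist certificate ⟹
  `BSD(E,p) ∧ BSD(E^{d_K},p)`).
* §2 THE SEMISTABLE END STATE over H∃♭, **`P2.bsdp_of_semistable_of_imcDivIntFrame`**: every
  semistable X11b pair at `p ≥ 5` (753 185 ‖ 30 086): `BSD_p` ⇐ PUB + cited + H∃♭ AT THE PAIR +
  [NOTHING on the Locus 723 144 ∣ ONE certificate (REG; or TC if `p ∤ ∏c`) on 30 041] — gen 23's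
  `P2.bsdp_of_semistable_of_imcDiv` WITHOUT `h32` (semistability is used only for `Surj` (Serre) and
  for the absence of the split-only residue / Disegni's (∗), both kernel theorems of gen 23).
* §3 THE CLASS RECORD **`P2.bsdp_of_onTree_intFrame`**: `∀ (E,p) ∈` X11b, `p ≥ 5 → BSD(E,p)` from
  published + cited facts and ONE typed shape H∃♭ on every pair (+ REG per pair, TC on 54 755 ‖ 3 291,
  the conjecture on 334 ‖ 35, the corner 64 ‖ 5).

CONDITIONAL on H∃♭ (open: (2.4) for Castella's `L_p(f)` ⇐ [FW21, Thm. 4.41], PREPRINT; on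
non-semistable pairs also Thms. 3.1/3.2 beyond their printed scope, [Castella 2024] PREPRINT — over
WHATEVER subring of `𝓞_{ℂ_p}` carries the coefficients); deletes nothing; labels UNCHANGED; X11b
stays CONSTRUCTION-SHAPED.

References: [Castella2018] Thms. 2.3, 3.1, 3.2, §5 (arXiv:1704.06608 pp. 5, 9, 12);
[Castella2018Erratum] (2.4), Thm. 1.1 (pp. 1, 4); [Hsieh2014] p. 7; [Disegni2020] Thm. 1, (∗);
[SteinWuthrich2013] Thm. 6.1, §4.2; [Wuthrich2014] Thm. 3, Prop. 21; [McCallumLMS1991] §1;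
[Serre1972] §5.4 Prop. 21 i); [Miller2011LMS] Def. 1.1.
-/

noncomputable section

open scoped Classical NumberField

open WeierstrassCurve NumberField IsDedekindDomain Field PowerSeries
open Literature.NumberTheory.EllipticCurves Literature.NumberTheory.EllipticCurves.GreenbergSelmer
open Literature.NumberTheory.EllipticCurves.ModularForms
open Literature.NumberTheory.EllipticCurves.Rank1Residual
open Literature.NumberTheory.EllipticCurves.Rank1Residual.Typed
open Literature.NumberTheory.EllipticCurves.Wuthrich2014
open Literature.NumberTheory.EllipticCurves.Castella2018
open Literature.NumberTheory.EllipticCurves.SteinWuthrich2013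
open Literature.NumberTheory.EllipticCurves.Disegni2020
open Literature.NumberTheory.EllipticCurves.Skinner2016
open Literature.NumberTheory.EllipticCurves.BalakrishnanEtAl2019
open Literature.NumberTheory.QuadraticFields.Quadratic
open Literature.NumberTheory.GaloisRepresentations Literature.NumberTheory.GaloisCohomology
open Summit.BirchSwinnertonDyer.Rank1Residual.X11b.AcSelmer
open Summit.BirchSwinnertonDyer.Rank1Residual.X11b.Halves

namespace Summit.BirchSwinnertonDyer.Rank1Residual.X11b

variable (W : WeierstrassCurve ℚ) [W.IsElliptic] [W.IsGloballyMinimal] (p : ℕ) [Fact p.Prime]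

/-! ### §1 Per-pair closures off the Locus, over H∃♭ -/

/-- **Any X11b ∧ surj pair at `p ≥ 5`: H∃♭ at the pair + ONE `p`-adic height ⟹ `BSD(E,p)`** (gen
21's `P2.bsdp_of_surj_of_regulatorNonvanishing` with the composite open input assembled from H∃♭):
the main-conjecture half from H∃♭ through the one-sided control, the Euler-system half from Kato's
divisibility (Wuthrich 2014 Thm. 3), Stein–Wuthrich 2013 Thm. 6.1 and Disegni 2020 Thm. 1 modulo the
non-vanishing of THE canonical `p`-adic height (REG) and, if split at `p`, Disegni's (∗) (a second
multiplicative prime). CONDITIONAL on H∃♭ and REG; per pair; nothing booked.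
[cite: Castella2018Erratum, (2.4) (p. 4)] [cite: Wuthrich2014, Thm. 3 (p. 383), Prop. 21 (p. 400)]
[cite: SteinWuthrich2013, Thm. 6.1, §4.2] [cite: Disegni2020, Thm. 1 (§1.2), Thm. 4, (∗)]
[cite: Miller2011LMS, Def. 1.1] -/
theorem P2.bsdp_of_surj_of_imcDivIntFrame_of_regulatorNonvanishing
    -- route p2's published inputs
    (hGZ : ∀ (N : ℕ) [NeZero N] (W : WeierstrassCurve ℚ) (K : Type) [Field K] [NumberField K],
      gross_zagier N W K)
    (hKo : ∀ (N : ℕ) [NeZero N] (W : WeierstrassCurve ℚ) (K : Type) [Field K] [NumberField K],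
      kolyvagin N W K)
    (hWu : sha_dvd_analyticSha) (hGZK : rank_eq_analyticRank_of_analyticRank_le_one)
    (hnf : exists_isNewformOf) (hHL : HoffsteinLuo1997_exists_twist_L_one_ne_zero)
    (hMaz : mazur_not_dvd_maninConstant_of_odd)
    (hPT : ∀ (K : Type) [Field K] [NumberField K], poitouTate_sum_localTatePairing_eq_zero K)
    (hEP : ∀ (K : Type) [Field K] [NumberField K] (v : HeightOneSpectrum (𝓞 K)),
      localEulerPoincareCharacteristic (v.adicCompletion K))
    -- the lever's published inputs
    (hK : kato_charIdeal_dvd_multiplicative_of_surjective)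
    (hJn : thm61_nonsplitMultiplicative) (hJs : thm61_splitMultiplicative)
    (hHn : exists_isMultCanonical) (hHs : exists_isSplitMultCanonical)
    (hD : thm1_padicBSD_rankOne_multiplicative) (hpar : nonempty_modularParametrizationData)
    -- the pair: H∃♭ at the pair; ONE `p`-adic height; X11b, `p ≥ 5`, surjective; (∗) if split
    (hF : P2.IMCDivIntFrameOnTree W p) (hReg : ClassClosure.RegulatorNonvanishingAt W p)
    (hX : ClassX11b W p) (hp5 : 5 ≤ p) (hsurj : Surj W p)
    (hstar : W.HasSplitMultiplicativeReductionAtPrime p →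
      ∃ (m : ℕ) (_ : Fact m.Prime), m ≠ p ∧ W.HasMultiplicativeReductionAtPrime m) :
    BSDp W p :=
  P2.bsdp_of_surj_of_regulatorNonvanishing W p hGZ hKo hWu hGZK
    (hasEntireLFunction_rat_of_exists_isNewformOf hnf) hnf hHL hMaz hPT hEP hK hJn hJs hHn hHs hD hpar
    (P2.openInputOnTreeAt_of_imcDivIntFrame hnf hGZK hKo hPT hEP hF) hReg hX hp5 hsurj hstar

/-- **X11b ∧ surj pair at `p ≥ 5` with `p ∤ ∏_ℓ c_ℓ(E)`: H∃♭ at the pair + ONE twist certificate ⟹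
`BSD(E,p)` AND `BSD(E^{d_K},p)`** (gen 22's `P2.bsdp_and_bsdp_twist_of_openInputAt_of_twistUnit` with
the open input from H∃♭): a Heegner field `K` (`d_K < −4`), a globally minimal model `Wd` of
`E^{d_K}` and its algebraic central value `q_d = L(E^{d_K},1)/Ω(Wd) ≠ 0` with `ord_p q_d = 0`. NO
`p`-adic height. CONDITIONAL on H∃♭; per pair; nothing booked.
[cite: McCallumLMS1991, §1 Theorem (Kolyvagin), p. 296] [cite: Castella2018Erratum, (2.4) (p. 4)]
[cite: JetchevSkinnerWan2017, §7.4.1 (pp. 30–31)] [cite: Miller2011LMS, Def. 1.1] -/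
theorem P2.bsdp_and_bsdp_twist_of_imcDivIntFrame_of_twistUnit
    (hGZ : ∀ (N : ℕ) [NeZero N] (W : WeierstrassCurve ℚ) (K : Type) [Field K] [NumberField K],
      gross_zagier N W K)
    (hKo : ∀ (N : ℕ) [NeZero N] (W : WeierstrassCurve ℚ) (K : Type) [Field K] [NumberField K],
      kolyvagin N W K)
    (hB : ∀ (N : ℕ) [NeZero N] (W : WeierstrassCurve ℚ) (K : Type) [Field K] [NumberField K],
      Kolyvagin1990_padicValNat_card_sha_le N W K)
    (hWu : sha_dvd_analyticSha) (hGZK : rank_eq_analyticRank_of_analyticRank_le_one)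
    (hnf : exists_isNewformOf) (hHL : HoffsteinLuo1997_exists_twist_L_one_ne_zero)
    (hMaz : mazur_not_dvd_maninConstant_of_odd)
    (hPT : ∀ (K : Type) [Field K] [NumberField K], poitouTate_sum_localTatePairing_eq_zero K)
    (hEP : ∀ (K : Type) [Field K] [NumberField K] (v : HeightOneSpectrum (𝓞 K)),
      localEulerPoincareCharacteristic (v.adicCompletion K))
    -- the pair: H∃♭ at the pair; X11b, `p ≥ 5`, surjective, `p ∤ ∏c`
    (hF : P2.IMCDivIntFrameOnTree W p)
    (hX : ClassX11b W p) (hp5 : 5 ≤ p) (hsurj : Surj W p) (htam : ¬ p ∣ W.tamagawaProduct)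
    -- the certificate
    (K : Type) [Field K] [NumberField K] (hK : IsImaginaryQuadratic K)
    (hHN : SatisfiesHeegnerHypothesis (W.conductorNorm ℤ) K) (hdK : NumberField.discr K < -4)
    (Wd : WeierstrassCurve ℚ) [Wd.IsElliptic] [Wd.IsGloballyMinimal] (Cd : VariableChange ℚ)
    (hWd : Cd • W.quadraticTwist (NumberField.discr K : ℚ) = Wd)
    (qd : ℚ) (hqd : Wd.entireLFunction 1 / (Wd.realPeriodRat : ℂ) = (qd : ℂ)) (hqd0 : qd ≠ 0)
    (hvd : padicValRat p qd = 0) :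
    BSDp W p ∧ BSDp Wd p :=
  P2.bsdp_and_bsdp_twist_of_openInputAt_of_twistUnit W p hGZ hKo hB hWu hGZK
    (hasEntireLFunction_rat_of_exists_isNewformOf hnf) hnf hHL hMaz hPT hEP
    (P2.openInputOnTreeAt_of_imcDivIntFrame hnf hGZK hKo hPT hEP hF) hX hp5 hsurj htam K hK hHN hdK
    Wd Cd hWd qd hqd hqd0 hvd

/-! ### §2 The semistable end state over H∃♭ — no `h32` -/

/-- **THE SEMISTABLE END STATE OF ROUTE p2 OVER H∃♭ (gen 24).** For every globally minimal SEMISTABLE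
elliptic `W/ℚ` and prime `p` with `(E,p)` in X11b and `p ≥ 5`: `BSD(E,p)` from published named facts
(route p2's + Kolyvagin 1990 Thm. A + Skinner 2016 Thm. C + the lever's), the two cited textbook facts
(Poitou–Tate, local Euler characteristic), the ONE OPEN input H∃♭ AT THE PAIR
(`P2.IMCDivIntFrameOnTree W p`: per datum a frame `Q ∈ 𝓞_{ℂ_p}⟦T⟧` with Thm. 3.1 ∧ Thm. 3.2 ∧ (2.4) —
on a semistable pair its first two conjuncts are the registered published fact read in `𝓞_{ℂ_p}⟦T⟧`
and its open content is (2.4) for Castella's `L_p(f)`, PREPRINT, over whatever subring of `𝓞_{ℂ_p}`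
carries the coefficients), and — ONLY OFF THE LOCUS (30 041 ‖ 1 429 of 753 185 ‖ 30 086 semistable
pairs) — ONE per-pair certificate: the `p`-adic height (REG), or, when `p ∤ ∏c`, a twist certificate
(TC). On the semistable Locus (723 144 ‖ 28 657) NOTHING per pair. NO `h32` binder (gen 23's
`P2.bsdp_of_semistable_of_imcDiv` needed it to produce the frame; here the frame is the typed input),
NO corner (Serre), NO (T2∗) conjecture (no split-only residue on semistable curves, gen 23), NO
Shimura display. CONDITIONAL; nothing booked; labels UNCHANGED; X11b stays CONSTRUCTION-SHAPED.
[cite: Castella2018Erratum, (2.4) (p. 4)] [cite: Castella2018, Thms. 2.3, 3.1, 3.2, §5]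
[cite: Skinner2016PacificMC, Thm. C (§1)] [cite: McCallumLMS1991, §1 Theorem (Kolyvagin), p. 296]
[cite: Disegni2020, Thm. 1 (§1.2), (∗)] [cite: Wuthrich2014, Thm. 3 (p. 383), Prop. 21 (p. 400)]
[cite: SteinWuthrich2013, Thm. 6.1, §4.2] [cite: Serre1972, §5.4 Prop. 21 i)] [cite: Miller2011LMS, Def. 1.1] -/
theorem P2.bsdp_of_semistable_of_imcDivIntFrame
    -- route p2's published inputs
    (hGZ : ∀ (N : ℕ) [NeZero N] (W : WeierstrassCurve ℚ) (K : Type) [Field K] [NumberField K],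
      gross_zagier N W K)
    (hKo : ∀ (N : ℕ) [NeZero N] (W : WeierstrassCurve ℚ) (K : Type) [Field K] [NumberField K],
      kolyvagin N W K)
    (hB : ∀ (N : ℕ) [NeZero N] (W : WeierstrassCurve ℚ) (K : Type) [Field K] [NumberField K],
      Kolyvagin1990_padicValNat_card_sha_le N W K)
    (hSk : Skinner2016.thmC_padicValRat_bsd_rank_zero) (hWu : sha_dvd_analyticSha)
    (hGZK : rank_eq_analyticRank_of_analyticRank_le_one) (hnf : exists_isNewformOf)
    (hHL : HoffsteinLuo1997_exists_twist_L_one_ne_zero) (hMaz : mazur_not_dvd_maninConstant_of_odd)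
    (hPT : ∀ (K : Type) [Field K] [NumberField K], poitouTate_sum_localTatePairing_eq_zero K)
    (hEP : ∀ (K : Type) [Field K] [NumberField K] (v : HeightOneSpectrum (𝓞 K)),
      localEulerPoincareCharacteristic (v.adicCompletion K))
    -- the lever's published inputs
    (hK : kato_charIdeal_dvd_multiplicative_of_surjective)
    (hJn : thm61_nonsplitMultiplicative) (hJs : thm61_splitMultiplicative)
    (hHn : exists_isMultCanonical) (hHs : exists_isSplitMultCanonical)
    (hD : thm1_padicBSD_rankOne_multiplicative) (hpar : nonempty_modularParametrizationData)
    -- the pair: semistable X11b, `p ≥ 5`; H∃♭ at the pair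
    (hss : Semistable W) (hF : P2.IMCDivIntFrameOnTree W p) (hX : ClassX11b W p) (hp5 : 5 ≤ p)
    -- OFF the Locus: ONE certificate — the `p`-adic height, or (`p ∤ ∏c`) a twist certificate
    (hcert : ¬ (Ram W p ∧ ¬ p ∣ W.tamagawaProduct) →
      ClassClosure.RegulatorNonvanishingAt W p ∨
      (¬ p ∣ W.tamagawaProduct ∧
        ∃ (K : Type) (_ : Field K) (_ : NumberField K) (Wd : WeierstrassCurve ℚ) (_ : Wd.IsElliptic)
          (_ : Wd.IsGloballyMinimal) (Cd : VariableChange ℚ) (qd : ℚ),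
          IsImaginaryQuadratic K ∧ SatisfiesHeegnerHypothesis (W.conductorNorm ℤ) K ∧
          NumberField.discr K < -4 ∧ Cd • W.quadraticTwist (NumberField.discr K : ℚ) = Wd ∧
          Wd.entireLFunction 1 / (Wd.realPeriodRat : ℂ) = (qd : ℂ) ∧ qd ≠ 0 ∧ padicValRat p qd = 0)) :
    BSDp W p := by
  have hsurj : Surj W p := surj_of_irr_of_semistable W p hX.2.2.2 hss
  by_cases hloc : Ram W p ∧ ¬ p ∣ W.tamagawaProduct
  · exact P2.bsdp_of_locus_of_imcDivIntFrame hGZ hKo hB hSk hWu hGZK hnf hHL hMaz hPT hEP hF hX hp5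
      hloc.1 hloc.2
  · rcases hcert hloc with hReg | ⟨htam, K, _, _, Wd, _, _, Cd, qd, hK', hHN, hdK, hWd, hqd, hqd0, hvd⟩
    · exact P2.bsdp_of_surj_of_imcDivIntFrame_of_regulatorNonvanishing W p hGZ hKo hWu hGZK hnf hHL
        hMaz hPT hEP hK hJn hJs hHn hHs hD hpar hF hReg hX hp5 hsurj
        (disegniStar_of_classX11b_of_semistable hnf hX hss)
    · exact (P2.bsdp_and_bsdp_twist_of_imcDivIntFrame_of_twistUnit W p hGZ hKo hB hWu hGZK hnf hHL
        hMaz hPT hEP hF hX hp5 hsurj htam K hK' hHN hdK Wd Cd hWd qd hqd hqd0 hvd).1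

/-! ### §3 The class-level record over H∃♭ -/

/-- **Route p2 — STATEMENT OF RECORD OVER THE `R₀`-FREE FRAME FORM (gen 24).** `∀ (E, p) ∈` X11b,
`p ≥ 5 → BSD(E, p)` from route p2's and the lever's published named facts (+ Kolyvagin 1990 Thm. A),
the cited Poitou–Tate / local Euler characteristic, and the typed inputs: **H∃♭
`P2.IMCDivIntFrameOnTree` ON EVERY PAIR** — per datum ONE frame `Q ∈ 𝓞_{ℂ_p}⟦T⟧` with Cas18 Thm.
3.1's interpolation ∧ Thm. 3.2's value at `𝟙` ∧ the erratum's divisibility (2.4), NO rationality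
clause on the coefficient ring (∃∧-currency; on semistable pairs the first two conjuncts are the
registered PUBLISHED fact read in `𝓞_{ℂ_p}⟦T⟧` and the open content is (2.4) for Castella's `L_p(f)`
⇐ [FW21 4.41] PRE; on non-semistable pairs all three are [Castella 2024 Thm. 3.1 + §2.3] PRE); (REG)
per pair; (TC) one twist certificate per split-only pair with `p ∤ ∏c` (54 755 ‖ 3 291); (T2∗′) the
conjecture `RelativeExceptionalLeadingTermAt` only on split-only pairs with `p ∣ ∏c` (334 ‖ 35);
(T4′) the corner (64 ‖ 5). NO `h32`, NO semistability case split, NO `R₀`. Gen 22's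
`P2.bsdp_of_onTree_cyclotomic_twistCertificate` with (T1) assembled from H∃♭ by
`P2.openInputOnTreeAt_of_imcDivIntFrame`. CONDITIONAL; nothing booked; labels UNCHANGED; X11b stays
CONSTRUCTION-SHAPED. [cite: Castella2018Erratum, (2.4) (p. 4)] [cite: Castella2018, Thms. 2.3, 3.1, 3.2]
[cite: Hsieh2014, p. 7 (arXiv:1112.1580)] [cite: McCallumLMS1991, §1 Theorem (Kolyvagin), p. 296]
[cite: Disegni2020, Thm. 1 (§1.2), Thm. 4, (∗)] [cite: Wuthrich2014, Thm. 3 (p. 383), Prop. 21 (p. 400)]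
[cite: SteinWuthrich2013, Thm. 6.1, §4.2] [cite: Miller2011LMS, Def. 1.1] -/
theorem P2.bsdp_of_onTree_intFrame
    -- route p2's published inputs
    (hGZ : ∀ (N : ℕ) [NeZero N] (W : WeierstrassCurve ℚ) (K : Type) [Field K] [NumberField K],
      gross_zagier N W K)
    (hKo : ∀ (N : ℕ) [NeZero N] (W : WeierstrassCurve ℚ) (K : Type) [Field K] [NumberField K],
      kolyvagin N W K)
    (hB : ∀ (N : ℕ) [NeZero N] (W : WeierstrassCurve ℚ) (K : Type) [Field K] [NumberField K],
      Kolyvagin1990_padicValNat_card_sha_le N W K)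
    (hWu : sha_dvd_analyticSha) (hGZK : rank_eq_analyticRank_of_analyticRank_le_one)
    (hnf : exists_isNewformOf) (hHL : HoffsteinLuo1997_exists_twist_L_one_ne_zero)
    (hMaz : mazur_not_dvd_maninConstant_of_odd) (hBDMTV : thm12_not_le_normalizer_splitCartan)
    (hPT : ∀ (K : Type) [Field K] [NumberField K], poitouTate_sum_localTatePairing_eq_zero K)
    (hEP : ∀ (K : Type) [Field K] [NumberField K] (v : HeightOneSpectrum (𝓞 K)),
      localEulerPoincareCharacteristic (v.adicCompletion K))
    -- the lever's published inputs
    (hK : kato_charIdeal_dvd_multiplicative_of_surjective)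
    (hJn : thm61_nonsplitMultiplicative) (hJs : thm61_splitMultiplicative)
    (hHn : exists_isMultCanonical) (hHs : exists_isSplitMultCanonical)
    (hD : thm1_padicBSD_rankOne_multiplicative) (hpar : nonempty_modularParametrizationData)
    -- THE ONE TYPED INPUT: H∃♭ (Cas18 3.1 ∧ 3.2 ∧ erratum (2.4) for one `Q ∈ 𝓞_{ℂ_p}⟦T⟧`), every pair
    (hF : ∀ (W : WeierstrassCurve ℚ) [W.IsElliptic] [W.IsGloballyMinimal] (p : ℕ) [Fact p.Prime],
      ClassX11b W p → 5 ≤ p → P2.IMCDivIntFrameOnTree W p)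
    -- (REG)
    (hReg : ∀ (W : WeierstrassCurve ℚ) [W.IsElliptic] [W.IsGloballyMinimal] (p : ℕ) [Fact p.Prime],
      ClassX11b W p → 5 ≤ p → ClassClosure.RegulatorNonvanishingAt W p)
    -- (TC) ONE twist certificate per split-only pair with `p ∤ ∏c`
    (hTC : ∀ (W : WeierstrassCurve ℚ) [W.IsElliptic] [W.IsGloballyMinimal] (p : ℕ) [Fact p.Prime],
      ClassX11b W p → 5 ≤ p → W.HasSplitMultiplicativeReductionAtPrime p →
      (¬ ∃ (m : ℕ) (_ : Fact m.Prime), m ≠ p ∧ W.HasMultiplicativeReductionAtPrime m) →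
      ¬ p ∣ W.tamagawaProduct →
      ∃ (K : Type) (_ : Field K) (_ : NumberField K) (Wd : WeierstrassCurve ℚ) (_ : Wd.IsElliptic)
        (_ : Wd.IsGloballyMinimal) (Cd : VariableChange ℚ) (qd : ℚ),
        IsImaginaryQuadratic K ∧ SatisfiesHeegnerHypothesis (W.conductorNorm ℤ) K ∧
        NumberField.discr K < -4 ∧ Cd • W.quadraticTwist (NumberField.discr K : ℚ) = Wd ∧
        Wd.entireLFunction 1 / (Wd.realPeriodRat : ℂ) = (qd : ℂ) ∧ qd ≠ 0 ∧ padicValRat p qd = 0)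
    -- (T2∗′) the exceptional conjecture, only on split-only pairs with `p ∣ ∏c`
    (hC : ∀ (W : WeierstrassCurve ℚ) [W.IsElliptic] [W.IsGloballyMinimal] (p : ℕ) [Fact p.Prime],
      ClassX11b W p → 5 ≤ p → W.HasSplitMultiplicativeReductionAtPrime p →
      (¬ ∃ (m : ℕ) (_ : Fact m.Prime), m ≠ p ∧ W.HasMultiplicativeReductionAtPrime m) →
      p ∣ W.tamagawaProduct → ClassClosure.RelativeExceptionalLeadingTermAt W p)
    -- (T4′)
    (hCorner : ∀ (W : WeierstrassCurve ℚ) [W.IsElliptic] [W.IsGloballyMinimal] (p : ℕ)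
      [Fact p.Prime], ClassX11b W p → ¬ Surj W p → (p = 5 ∨ p = 7) →
        p ∣ padicValInt p W.minimalDiscriminantInt → ¬ Ram W p → Typed.MissingPPartAt W p)
    (W : WeierstrassCurve ℚ) [W.IsElliptic] [W.IsGloballyMinimal] (p : ℕ) [Fact p.Prime]
    (hX : ClassX11b W p) (hp5 : 5 ≤ p) : BSDp W p :=
  P2.bsdp_of_onTree_cyclotomic_twistCertificate hGZ hKo hB hWu hGZK
    (hasEntireLFunction_rat_of_exists_isNewformOf hnf) hnf hHL hMaz hBDMTV hPT hEP hK hJn hJs hHn hHs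
    hD hpar
    (fun W _ _ p _ N _ K _ _ Dt H ι P hX hp5 ↦
      P2.openInputOnTreeAt_of_imcDivIntFrame hnf hGZK hKo hPT hEP (hF W p hX hp5) N K Dt H ι P hX hp5)
    hReg hTC hC hCorner W p hX hp5

/-- **H∃♭ is the weakest of route p2's open-input currencies**: over gen 23's frame form the gen-24
record is a COROLLARY (`P2.imcDivIntFrameOnTree_of_imcDivFrame` pointwise), so nothing recorded before
is lost by the change of receptacle. CONDITIONAL on the frame form.
[cite: Castella2018Erratum, (2.4) (p. 4)] [cite: Castella2018, Thms. 3.1–3.2 (arXiv:1704.06608 p. 9)] -/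
theorem P2.imcDivIntFrameOnTree_forall_of_imcDivFrame_forall
    (hF : ∀ (W : WeierstrassCurve ℚ) [W.IsElliptic] [W.IsGloballyMinimal] (p : ℕ) [Fact p.Prime],
      ClassX11b W p → 5 ≤ p → P2.IMCDivFrameOnTree W p)
    (W : WeierstrassCurve ℚ) [W.IsElliptic] [W.IsGloballyMinimal] (p : ℕ) [Fact p.Prime]
    (hX : ClassX11b W p) (hp5 : 5 ≤ p) : P2.IMCDivIntFrameOnTree W p :=
  P2.imcDivIntFrameOnTree_of_imcDivFrame (hF W p hX hp5)

end Summit.BirchSwinnertonDyer.Rank1Residual.X11b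

end
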